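import Literature.AlgebraicGeometry.Resolution.OrderGenerization
import Literature.AlgebraicGeometry.Resolution.PrimeDivisorIdeals
import HarnessLib

/-!
# The order of an ideal sheaf does not decrease under specialization

Topic: `Literature/AlgebraicGeometry/Resolution`. Scheme-level form of `OrderGenerization.lean`:
on a scheme `X`, for a specialization `ζ ⤳ x` with `𝒪_{X,x}` a regular local ring and an ideal
sheaf `I`, **`ord_ζ(I) ≤ ord_x(I)`** (`idealOrder_le_of_specializes`), i.e. `I_ζ ⊆ 𝔪_ζⁿ` implies
`I_x ⊆ 𝔪_xⁿ` (`stalkIdeal_le_pow_of_specializes`). Consequently on a regular scheme the loci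
`{x | ord_x(I) ≥ n}` are stable under specialization — the pointwise half of "`Σ := {x ∈ X |
m(x) = μ}` … is a closed subset of `X`" in the proof of Cossart–Piltant 2008, Prop. 4.2 (the other
half, constructibility along curves, needs excellence). Inputs: `𝒪_{X,ζ}` is the localization of
`𝒪_{X,x}` at a prime (`StalkSpecializesLocalization.lean`, Stacks 01J7), `I_ζ = I_x 𝒪_{X,ζ}`
(`stalkIdeal_map_stalkSpecializes`), and `ord_P J ≤ ord_𝔪 J` in a regular local ring
(`le_pow_of_map_le_pow`).

## References

* V. Cossart, O. Piltant, J. Algebra 320 (2008), proof of Prop. 4.2. [cite: CossartPiltant2008, Prop. 4.2 (proof)]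
* The Stacks Project, Tag 01J7. [cite: StacksProject, Tag 01J7]
-/

noncomputable section

open CategoryTheory AlgebraicGeometry TopologicalSpace IsLocalRing

namespace Literature.AlgebraicGeometry.Resolution

universe u

variable {X : Scheme.{u}}

/-- **`I_ζ ⊆ 𝔪_ζⁿ ⟹ I_x ⊆ 𝔪_xⁿ`** for a specialization `ζ ⤳ x` with `𝒪_{X,x}` regular.
[cite: CossartPiltant2008, Prop. 4.2 (proof)] -/
theorem stalkIdeal_le_pow_of_specializes {ζ x : X} (h : ζ ⤳ x)
    [IsRegularLocalRing (X.presheaf.stalk x)] (I : X.IdealSheafData) {n : ℕ}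
    (hζ : stalkIdeal I ζ ≤ maximalIdeal (X.presheaf.stalk ζ) ^ n) :
    stalkIdeal I x ≤ maximalIdeal (X.presheaf.stalk x) ^ n := by
  letI := (X.presheaf.stalkSpecializes h).hom.toAlgebra
  haveI hP : ((maximalIdeal (X.presheaf.stalk ζ)).comap (X.presheaf.stalkSpecializes h).hom).IsPrime :=
    Ideal.comap_isPrime _ _
  haveI := isLocalizationAtPrime_stalkSpecializes h
  refine le_pow_of_map_le_pow
    ((maximalIdeal (X.presheaf.stalk ζ)).comap (X.presheaf.stalkSpecializes h).hom)
    (X.presheaf.stalk ζ) ?_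
  rw [RingHom.algebraMap_toAlgebra, stalkIdeal_map_stalkSpecializes]
  exact hζ

/-- **The order does not decrease under specialization**: `ord_ζ(I) ≤ ord_x(I)` for `ζ ⤳ x`
with `𝒪_{X,x}` regular. [cite: CossartPiltant2008, Prop. 4.2 (proof)] -/
theorem idealOrder_le_of_specializes {ζ x : X} (h : ζ ⤳ x)
    [IsRegularLocalRing (X.presheaf.stalk x)] (I : X.IdealSheafData) :
    idealOrder I ζ ≤ idealOrder I x := by
  refine ENat.forall_natCast_le_iff_le.mp fun n hn => ?_
  rw [le_idealOrder_iff] at hn ⊢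
  exact stalkIdeal_le_pow_of_specializes h I hn

/-- On a regular scheme the loci `{x | n ≤ ord_x(I)}` are stable under specialization.
[cite: CossartPiltant2008, Prop. 4.2 (proof)] -/
theorem stableUnderSpecialization_setOf_le_idealOrder (hX : Scheme.IsRegular X)
    (I : X.IdealSheafData) (n : ℕ∞) :
    StableUnderSpecialization {x : X | n ≤ idealOrder I x} := by
  intro ζ x h hζ
  haveI := hX x
  exact le_trans hζ (idealOrder_le_of_specializes h I)

end Literature.AlgebraicGeometry.Resolution

end
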